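import Literature.NumberTheory.PAdicHodge.TateSemiInvariantCharacterLevel
import Literature.NumberTheory.PAdicHodge.TateCocycleTransferContinuous
import Literature.NumberTheory.PAdicHodge.UnramifiedUnitPeriodMatrixC
import Literature.NumberTheory.PAdicHodge.SemiInvariantMultiplicationMatrix
import Literature.NumberTheory.GaloisRepresentations.UnramifiedAdmissible
import Mathlib.Topology.Algebra.Module.FiniteDimension
import HarnessLib

/-!
# Tate's level theorem for semi-invariant vectors over `Γ_F` (degree one) and the unramified twist

Literature layer (NumberTheory ▸ PAdicHodge ▸ Sen–Tate theory with coefficients; theorems only).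

Let `F/ℚ_p` be a non-archimedean local field of residue characteristic `p` **of degree one**, i.e.
the canonical embedding `ι : ℚ_p → F` (`LocalField.padicRingHom`) is surjective, so that Tate's base
field `K₀ = ℚ_p ⊆ F` is all of `F` and `Γ_F → G₀ = Gal(F̄/K₀)` (`BaseGaloisGroup.toBase`) is a
bijection (`toBase_bijective_of_surjective`).  Let `E/ℚ_p` be a finite-dimensional coefficient field with
a `ℚ_p`-basis `b`, and write `L_b(e) ∈ M_κ(ℚ_p)` for the matrix of multiplication by `e ∈ E`
(`Algebra.leftMulMatrix b e`).

* `exists_level_of_semiInvariant` — **Tate's theorem, `Γ_F`-form.**  Let `ν : Γ_F → Eˣ` be a character,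
  trivial on `ker χ` (`χ` the cyclotomic character) and with continuous regular representation
  `σ ↦ L_b(ν σ)`, admitting a non-zero semi-invariant vector `z ∈ ℂ_F^κ`:
  `σ • z_k = Σ_m ι(L_b(ν σ)_{k m}) z_m`.  Then `ν` has finite level: there is `N ≥ 1` with `ν(σ) = 1`
  whenever `χ(σ) ≡ 1 (mod p^N)`.  This is the tree's `G₀`-form
  `TateTrace.exists_level_eq_one_of_semiInvariant_of_eventually` (Tate 1967, §3.3 Theorem 2: the
  semi-invariants of `ℂ_F` for a character of infinite order on `Gal(K_∞/K₀)` vanish) transported along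
  `Γ_F ≃ G₀` — a homeomorphism, `toBase` being a continuous bijection from a compact to a Hausdorff group.
* `exists_semiInvariant_unramified_twist` — **the unramified twist.**  If `x ≠ 0` is semi-invariant for
  `σ ↦ L_b(e₁ σ)` and `μ : Γ_F → Eˣ` is a character whose regular representation in the basis `b` is an
  *unramified integral frame* `r : Γ_F → GL_N(ℤ_p)`, then some `z ≠ 0` is semi-invariant for
  `σ ↦ L_b(e₁(σ) μ(σ⁻¹))`: take a unit period matrix `Y` of `r` over `ℂ_F`
  (`UnramifiedUnitPeriods.exists_isUnit_forall_smul_col_eq_mulVec`, from `𝒪_ℂ/p ⊇ 𝔽̄_p` and completeness)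
  and `z := P_x y` for a suitable column `y` of `Y`, `P_x = Σ_i x_i L_b(b_i)` the multiplication matrix
  of `x` (`SemiInvariant.comp_mulMatrix_mulVec_of_semiInvariant`, `exists_mulMatrix_mulVec_col_ne_zero`).
* `exists_basis_integralFrame_character` — the regular representation of a continuous character
  `μ : Γ_F → Eˣ` trivial on inertia admits a basis `b` of `E/ℚ_p` in which it is an unramified integral
  frame (Serre's compactness argument, `ContinuousRep.exists_basis_integralFrame`).
* `continuous_leftMulMatrix_apply` — the entries of `L_b` are continuous (linear maps on a
  finite-dimensional Hausdorff `ℚ_p`-space are continuous).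

These are the coefficient-field forms of the ingredients of Tate's theorem that a Hodge–Tate (here: de
Rham) character of `Γ_{ℚ_p}` with values in `E` is locally algebraic (Serre, *Abelian ℓ-adic
representations*, Ch. III, Appendix, Theorem 2; Tate 1967, §3.3).

References: J. Tate, *p-divisible groups* (1967), §3.1, §3.3 [Tate1967]; J.-P. Serre, *Abelian ℓ-adic
representations and elliptic curves* (1968), Ch. I §1.1, Ch. III §A [SerreAbelianLadic1968]; J.-P. Serre,
*Local Fields*, Ch. VII §5 [SerreLocalFields1979].
-/

noncomputable section

open Field ValuativeRel Matrix Topology Filter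

namespace Literature.NumberTheory.PAdicHodge

open Literature.NumberTheory.GaloisRepresentations
open Literature.NumberTheory.GaloisRepresentations.IsNonarchimedeanLocalField
open CyclotomicTower

namespace DegreeOneLevel

variable {F : Type} [Field F] [ValuativeRel F] [TopologicalSpace F] [IsNonarchimedeanLocalField F]
  [CharZero F] {p : ℕ} [Fact p.Prime] (hp : valuation F p < 1)

/-! ### `Γ_F = G₀` in degree one -/

/-- **`Γ_F → G₀` is bijective when `ℚ_p → F` is onto**: a `K₀`-automorphism of `F̄` then fixes
`F = ι(ℚ_p)` pointwise, so it lies in the image of `Γ_F` (`BaseGaloisGroup.exists_toBase_eq`).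
[cite: Tate1967, §3.1] -/
theorem toBase_bijective_of_surjective (hdeg : Function.Surjective (LocalField.padicRingHom F p hp)) :
    Function.Bijective (BaseGaloisGroup.toBase hp) := by
  refine ⟨BaseGaloisGroup.toBase_injective hp, fun g => ?_⟩
  refine BaseGaloisGroup.exists_toBase_eq hp g fun c => ?_
  obtain ⟨a, rfl⟩ := hdeg c
  have h : algebraMap F (NormedAlgClosure F) (LocalField.padicRingHom F p hp a) =
      algebraMap (PadicBase F p hp) (NormedAlgClosure F) ((PadicBase.toPadic hp).symm a) := by
    rw [IsScalarTower.algebraMap_apply (PadicBase F p hp) F (NormedAlgClosure F)]; rfl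
  rw [h, BaseGaloisGroup.smul_algebraMap]

/-! ### Continuity of the regular representation -/

/-- **Entries of the regular representation are continuous**: for a `ℚ_p`-basis `b` of a
finite-dimensional Hausdorff topological `ℚ_p`-algebra `E`, each entry `e ↦ L_b(e)_{k m} = b^*_k(e b_m)`
is a `ℚ_p`-linear, hence continuous, function of `e`; so `x ↦ L_b(f x)_{k m}` is continuous for
continuous `f`. [cite: SerreAbelianLadic1968, Ch. I §1.1] -/
theorem continuous_leftMulMatrix_apply {E : Type} [Field E] [Algebra ℚ_[p] E] [TopologicalSpace E]
    [IsTopologicalRing E] [ContinuousSMul ℚ_[p] E] [T2Space E] [FiniteDimensional ℚ_[p] E]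
    {κ : Type} [Fintype κ] [DecidableEq κ] (b : Module.Basis κ ℚ_[p] E) {X : Type*}
    [TopologicalSpace X] {f : X → E} (hf : Continuous f) (k m : κ) :
    Continuous fun x => Algebra.leftMulMatrix b (f x) k m := by
  have hlin : Continuous fun e : E => Algebra.leftMulMatrix b e k m := by
    have h : (fun e : E => Algebra.leftMulMatrix b e k m) =
        fun e => ((b.coord k).comp (LinearMap.mulRight ℚ_[p] (b m))) e := by
      funext e
      rw [Algebra.leftMulMatrix_eq_repr_mul, LinearMap.comp_apply, LinearMap.mulRight_apply,
        Module.Basis.coord_apply]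
    rw [h]
    exact LinearMap.continuous_of_finiteDimensional _
  exact hlin.comp hf

/-! ### Tate's theorem over `Γ_F` -/

/-- **Tate's level theorem, `Γ_F`-form in degree one.**  Let `ι : ℚ_p → F` be onto, `E/ℚ_p` a field
with basis `b`, and `ν : Γ_F → Eˣ` a character trivial on `ker χ` whose regular representation
`σ ↦ L_b(ν σ)` has continuous entries.  If some `z ≠ 0` in `ℂ_F^κ` is semi-invariant,
`σ • z_k = Σ_m ι(L_b(ν σ)_{k m}) z_m`, then `ν` has finite level: `ν(σ) = 1` whenever
`χ(σ) ≡ 1 (mod p^N)`, for some `N ≥ 1`.  (Tate: the `(ψ)`-semi-invariants of `E ⊗ ℂ_F` under `G₀` vanish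
for `ψ` of infinite order on `Gal(K_∞/K₀) ≅ ℤ_p^×`; here `Γ_F = G₀`.)
[cite: Tate1967, §3.3 Theorem 2] [cite: SerreAbelianLadic1968, Ch. III, Appendix] -/
theorem exists_level_of_semiInvariant (hdeg : Function.Surjective (LocalField.padicRingHom F p hp))
    {E : Type} [Field E] [Algebra ℚ_[p] E] {κ : Type} [Fintype κ] [DecidableEq κ]
    (b : Module.Basis κ ℚ_[p] E) (ν : absoluteGaloisGroup F →* Eˣ)
    (hνχ : ∀ σ, GaloisRep.cyclotomicCharacter F p σ = 1 → ν σ = 1)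
    (hcont : ∀ k m, Continuous fun σ => Algebra.leftMulMatrix b (ν σ : E) k m)
    {z : κ → CompletedAlgClosure F} (hz0 : z ≠ 0)
    (hz : ∀ (σ : absoluteGaloisGroup F) (k : κ), σ • z k =
      ∑ m, algebraMap F (CompletedAlgClosure F)
        (LocalField.padicRingHom F p hp (Algebra.leftMulMatrix b (ν σ : E) k m)) * z m) :
    ∃ N : ℕ, 0 < N ∧ ∀ σ : absoluteGaloisGroup F,
      PadicInt.toZModPow N ((GaloisRep.cyclotomicCharacter F p σ : ℤ_[p]ˣ) : ℤ_[p]) = 1 →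
        ν σ = 1 := by
  classical
  haveI : CompactSpace (absoluteGaloisGroup F) := absoluteGaloisGroup_compactSpace F
  have hbij := toBase_bijective_of_surjective hp hdeg
  -- `Γ_F ≃ G₀` as groups and as topological spaces
  let e : absoluteGaloisGroup F ≃* BaseGaloisGroup hp :=
    MulEquiv.ofBijective (BaseGaloisGroup.toBase hp) hbij
  have he : ∀ σ, e σ = BaseGaloisGroup.toBase hp σ := fun _ => rfl
  have hes : ∀ g, BaseGaloisGroup.toBase hp (e.symm g) = g := fun g => by
    rw [← he, MulEquiv.apply_symm_apply]
  have hse : ∀ σ, e.symm (BaseGaloisGroup.toBase hp σ) = σ := fun σ => by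
    rw [← he, MulEquiv.symm_apply_apply]
  let eT : absoluteGaloisGroup F ≃ₜ BaseGaloisGroup hp :=
    Continuous.homeoOfEquivCompactToT2 (f := Equiv.ofBijective _ hbij)
      (BaseGaloisGroup.continuous_toBase hp)
  have hsymm_cont : Continuous fun g => e.symm g := eT.symm.continuous
  -- the coefficient field over `K₀ = ℚ_p`
  letI : Algebra (PadicBase F p hp) E := ‹Algebra ℚ_[p] E›
  let bK : Module.Basis κ (PadicBase F p hp) E := b
  let ψ : BaseGaloisGroup hp →* Eˣ := ν.comp e.symm.toMonoidHom
  have hψ : ∀ g, ψ g = ν (e.symm g) := fun _ => rfl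
  -- `ψ` is trivial on the subgroup fixing `K_∞`
  have hH : ∀ g : BaseGaloisGroup hp, (∀ M, g • zeta F p M = zeta F p M) → ψ g = 1 := by
    intro g hg
    rw [hψ]
    apply hνχ
    rw [← BaseGaloisGroup.baseCyclotomicCharacter_toBase hp, hes]
    exact Units.ext (PadicInt.ext_of_toZModPow.mp fun M => by
      rw [TateTrace.toZModPow_chi_eq_one hp (hg M), Units.val_one, map_one])
  -- the regular representation of `ψ` is continuous at `1`
  have hcont' : ∀ ε : ℝ, 0 < ε → ∀ᶠ g in 𝓝 (1 : BaseGaloisGroup hp),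
      ∀ k m, ‖(Algebra.leftMulMatrix bK (ψ g : E) - 1) k m‖ < ε := by
    intro ε hε
    have h1 : ∀ k m, ∀ᶠ σ in 𝓝 (1 : absoluteGaloisGroup F),
        ‖(Algebra.leftMulMatrix bK (ν σ : E) - 1) k m‖ < ε := by
      intro k m
      have hf : Continuous fun σ : absoluteGaloisGroup F =>
          (Algebra.leftMulMatrix bK (ν σ : E) - 1) k m := by
        letI := nontriviallyNormedField F
        rw [(PadicBase.isometry_algebraMap hp).isEmbedding.continuous_iff]
        have hco : (algebraMap (PadicBase F p hp) F) ∘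
            (fun σ : absoluteGaloisGroup F => (Algebra.leftMulMatrix bK (ν σ : E) - 1) k m) =
            fun σ => LocalField.padicRingHom F p hp
              (Algebra.leftMulMatrix b (ν σ : E) k m - (1 : Matrix κ κ ℚ_[p]) k m) := by
          funext σ; rfl
        rw [hco]
        exact (LocalField.continuous_padicRingHom F p hp).comp ((hcont k m).sub continuous_const)
      have h0 : (Algebra.leftMulMatrix bK (ν 1 : E) - 1) k m = 0 := by
        rw [map_one, Units.val_one, map_one, sub_self, Matrix.zero_apply]
      have h2 := Metric.tendsto_nhds.mp (hf.tendsto 1) ε hε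
      simp only [dist_eq_norm, h0, sub_zero] at h2
      exact h2
    have h2 : ∀ᶠ σ in 𝓝 (1 : absoluteGaloisGroup F),
        ∀ k m, ‖(Algebra.leftMulMatrix bK (ν σ : E) - 1) k m‖ < ε :=
      Filter.eventually_all.mpr fun k => Filter.eventually_all.mpr fun m => h1 k m
    have h3 : Tendsto (fun g => e.symm g) (𝓝 (1 : BaseGaloisGroup hp))
        (𝓝 (1 : absoluteGaloisGroup F)) := by
      have h := hsymm_cont.tendsto (1 : BaseGaloisGroup hp)
      rwa [map_one] at h
    exact (h3.eventually h2).mono fun g hg => hg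
  -- semi-invariance under `G₀`
  have hγ : ∀ (g : BaseGaloisGroup hp) (k : κ),
      g • z k = ∑ m, TateTrace.ι hp (Algebra.leftMulMatrix bK (ψ g : E) k m) * z m := by
    intro g k
    conv_lhs => rw [← hes g, CompletedAlgClosure.toBase_smul_completion]
    rw [hz]
    rfl
  obtain ⟨N, hN⟩ :=
    TateTrace.exists_level_eq_one_of_semiInvariant_of_eventually hp bK ψ hH hcont' hz0 hγ
  refine ⟨N + 1, N.succ_pos, fun σ hσ => ?_⟩
  -- `σ` fixes `ζ_{p^{N+1}}`, hence `ζ_{p^N}`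
  haveI : Fact (1 < p ^ (N + 1)) := ⟨Nat.one_lt_pow N.succ_ne_zero (Fact.out : p.Prime).one_lt⟩
  have hfix : BaseGaloisGroup.toBase hp σ • zeta F p (N + 1) = zeta F p (N + 1) := by
    rw [BaseGaloisGroup.baseCyclotomicCharacter_spec hp (BaseGaloisGroup.toBase hp σ)
      (zeta F p (N + 1)) (zeta_spec F p (N + 1)).pow_eq_one,
      BaseGaloisGroup.baseCyclotomicCharacter_toBase, hσ, ZMod.val_one, pow_one]
  have h := hN (BaseGaloisGroup.toBase hp σ) (TateTrace.smul_zeta_eq_of_level_le hp N.le_succ hfix)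
  rwa [hψ, hse] at h

/-! ### Integral frames of unramified characters -/

omit [CharZero F] in
/-- **Integral frame of the regular representation of an unramified character.**  A continuous
character `μ : Γ_F → Eˣ`, trivial on the inertia group, acting on the finite-dimensional Hausdorff
`ℚ_p`-algebra `E` by multiplication, admits a `ℚ_p`-basis `b` of `E` in which it is given by a continuous
homomorphism `r : Γ_F → GL_N(ℤ_p)` (a compact group stabilises a lattice), and `r` is then trivial on
inertia. [cite: SerreAbelianLadic1968, Ch. I §1.1] -/
theorem exists_basis_integralFrame_character {E : Type} [Field E] [Algebra ℚ_[p] E]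
    [TopologicalSpace E] [IsTopologicalRing E] [ContinuousSMul ℚ_[p] E] [T2Space E]
    [FiniteDimensional ℚ_[p] E] (μ : absoluteGaloisGroup F →* Eˣ) (hμc : Continuous μ)
    (hμI : ∀ σ ∈ absInertia F, μ σ = 1) :
    ∃ (b : Module.Basis (Fin (Module.finrank ℚ_[p] E)) ℚ_[p] E)
      (r : absoluteGaloisGroup F →ₜ* GL (Fin (Module.finrank ℚ_[p] E)) ℤ_[p]),
      (∀ σ ∈ absInertia F, r σ = 1) ∧
      ∀ σ, Algebra.leftMulMatrix b (μ σ : E) =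
        ((r σ : GL (Fin (Module.finrank ℚ_[p] E)) ℤ_[p]) :
          Matrix (Fin (Module.finrank ℚ_[p] E)) (Fin (Module.finrank ℚ_[p] E)) ℤ_[p]).map
          (fun a : ℤ_[p] => (a : ℚ_[p])) := by
  classical
  haveI : CompactSpace (absoluteGaloisGroup F) := absoluteGaloisGroup_compactSpace F
  have hμc' : Continuous fun σ => (μ σ : E) := Units.continuous_val.comp hμc
  -- the regular representation of `μ`
  let ρ : ContinuousRep (absoluteGaloisGroup F) ℚ_[p] E :=
    { toRepresentation := (Algebra.lmul ℚ_[p] E).toMonoidHom.comp ((Units.coeHom E).comp μ)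
      continuous_smul := by
        show Continuous fun q : absoluteGaloisGroup F × E => (μ q.1 : E) * q.2
        exact (hμc'.comp continuous_fst).mul continuous_snd }
  have hρ : ∀ σ (v : E), ρ σ v = (μ σ : E) * v := fun _ _ => rfl
  obtain ⟨b, r, hbr⟩ := ρ.exists_basis_integralFrame
  have hL : ∀ σ, Algebra.leftMulMatrix b (μ σ : E) =
      ((r σ : GL (Fin (Module.finrank ℚ_[p] E)) ℤ_[p]) :
        Matrix (Fin (Module.finrank ℚ_[p] E)) (Fin (Module.finrank ℚ_[p] E)) ℤ_[p]).map
        (fun a : ℤ_[p] => (a : ℚ_[p])) := by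
    intro σ
    ext i j
    have hc : ⇑(b.repr (∑ i, (((r σ : GL (Fin (Module.finrank ℚ_[p] E)) ℤ_[p]) :
        Matrix (Fin (Module.finrank ℚ_[p] E)) (Fin (Module.finrank ℚ_[p] E)) ℤ_[p]) i j : ℚ_[p]) •
          b i)) =
        fun i => (((r σ : GL (Fin (Module.finrank ℚ_[p] E)) ℤ_[p]) :
          Matrix (Fin (Module.finrank ℚ_[p] E)) (Fin (Module.finrank ℚ_[p] E)) ℤ_[p]) i j : ℚ_[p]) :=
      b.repr_sum_self _
    rw [Algebra.leftMulMatrix_eq_repr_mul, Matrix.map_apply, ← hρ, hbr σ j, hc]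
  refine ⟨b, r, fun σ hσ => ?_, hL⟩
  -- on inertia `μ = 1`, so `r = 1`
  have h1 : ((r σ : GL (Fin (Module.finrank ℚ_[p] E)) ℤ_[p]) :
      Matrix (Fin (Module.finrank ℚ_[p] E)) (Fin (Module.finrank ℚ_[p] E)) ℤ_[p]).map
        (fun a : ℤ_[p] => (a : ℚ_[p])) =
      (1 : Matrix (Fin (Module.finrank ℚ_[p] E)) (Fin (Module.finrank ℚ_[p] E)) ℤ_[p]).map
        (fun a : ℤ_[p] => (a : ℚ_[p])) := by
    rw [← hL σ, hμI σ hσ, Units.val_one, map_one,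
      Matrix.map_one (fun a : ℤ_[p] => (a : ℚ_[p])) rfl rfl]
  exact Units.ext (Matrix.map_injective Subtype.val_injective h1)

/-! ### The unramified twist -/

/-- **The unramified twist of a semi-invariant vector.**  Let `x ≠ 0` in `ℂ_F^N` be semi-invariant for
`σ ↦ L_b(e₁ σ)`, `σ • x_k = Σ_j ι(L_b(e₁ σ)_{k j}) x_j`, and let `μ : Γ_F → Eˣ` be a character whose
regular representation in the same basis `b` is an unramified integral frame `r`.  Then some `z ≠ 0`
is semi-invariant for `σ ↦ L_b(e₁(σ) μ(σ⁻¹))`: with a unit period matrix `Y` of `r`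
(`σ • Y = r(σ⁻¹) Y`, from `𝔽̄_p ⊆ 𝒪_ℂ/p` and completeness of `ℂ_F`) and the multiplication matrix
`P_x = Σ_i x_i L_b(b_i)` of `x`, the vector `z = P_x y` for a column `y` of `Y` works, and is non-zero
for some column since `P_x Y = 0` would force `x = P_x b^*(1) = 0`.
[cite: Tate1967, §3.3] [cite: SerreAbelianLadic1968, Ch. III, Appendix] -/
theorem exists_semiInvariant_unramified_twist {E : Type} [Field E] [Algebra ℚ_[p] E] {N : ℕ}
    (b : Module.Basis (Fin N) ℚ_[p] E) (μ : absoluteGaloisGroup F →* Eˣ)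
    (r : absoluteGaloisGroup F →ₜ* GL (Fin N) ℤ_[p]) (hr : ∀ σ ∈ absInertia F, r σ = 1)
    (hμr : ∀ σ, Algebra.leftMulMatrix b (μ σ : E) =
      ((r σ : GL (Fin N) ℤ_[p]) : Matrix (Fin N) (Fin N) ℤ_[p]).map (fun a : ℤ_[p] => (a : ℚ_[p])))
    (e₁ : absoluteGaloisGroup F → E) {x : Fin N → CompletedAlgClosure F} (hx0 : x ≠ 0)
    (hx : ∀ (σ : absoluteGaloisGroup F) (k : Fin N), σ • x k =
      ∑ j, algebraMap F (CompletedAlgClosure F)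
        (LocalField.padicRingHom F p hp (Algebra.leftMulMatrix b (e₁ σ) k j)) * x j) :
    ∃ z : Fin N → CompletedAlgClosure F, z ≠ 0 ∧
      ∀ (σ : absoluteGaloisGroup F) (k : Fin N), σ • z k =
        ∑ j, algebraMap F (CompletedAlgClosure F)
          (LocalField.padicRingHom F p hp
            (Algebra.leftMulMatrix b (e₁ σ * (μ σ⁻¹ : E)) k j)) * z j := by
  classical
  letI : Algebra ℚ_[p] F := LocalField.padicAlgebra F p hp
  -- a unit period matrix of the unramified integral frame `r`
  obtain ⟨Y, hYu, hY⟩ := UnramifiedUnitPeriods.exists_isUnit_forall_smul_col_eq_mulVec r hr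
  -- the scalars `ι : ℚ_p → F → ℂ_F`
  let ι : ℚ_[p] →+* CompletedAlgClosure F :=
    (algebraMap F (CompletedAlgClosure F)).comp (LocalField.padicRingHom F p hp)
  have hιa : ∀ a, ι a =
      algebraMap F (CompletedAlgClosure F) (LocalField.padicRingHom F p hp a) := fun _ => rfl
  obtain ⟨i, hi⟩ := SemiInvariant.exists_mulMatrix_mulVec_col_ne_zero b ι hx0 hYu
  refine ⟨_, hi, fun σ k => ?_⟩
  -- `σ` as a ring endomorphism of `ℂ_F` fixing `ι(ℚ_p)`
  let φ : CompletedAlgClosure F →+* CompletedAlgClosure F :=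
    MulSemiringAction.toRingHom (absoluteGaloisGroup F) (CompletedAlgClosure F) σ
  have hφa : ∀ c, φ c = σ • c := fun _ => rfl
  have hφ : ∀ a, φ (ι a) = ι a := fun a => by
    rw [hφa, hιa]
    exact CompletedAlgClosure.smul_algebraMap σ _
  have hx' : φ ∘ x = (Algebra.leftMulMatrix b (e₁ σ)).map ι *ᵥ x := by
    funext k'
    rw [Function.comp_apply, hφa, hx]
    simp only [Matrix.mulVec, dotProduct, Matrix.map_apply, hιa]
  have hy' : φ ∘ (fun k => Y k i) =
      (Algebra.leftMulMatrix b (μ σ⁻¹ : E)).map ι *ᵥ fun k => Y k i := by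
    rw [hμr, Matrix.map_map]
    funext k'
    rw [Function.comp_apply, hφa]
    exact congrFun (hY σ i) k'
  have key := congrFun (SemiInvariant.comp_mulMatrix_mulVec_of_semiInvariant b ι φ hφ hx' hy') k
  rw [Function.comp_apply, hφa] at key
  rw [key]
  simp only [Matrix.mulVec, dotProduct, Matrix.map_apply, hιa]

end DegreeOneLevel

end Literature.NumberTheory.PAdicHodge

end
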